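import Summits.Ventures.PercRepro.S2TopCountCell

/-!
# PercRepro — S2: THE RANK-`≤ 5` TAIL OF A SPREAD CORE (p7, gen 12; sub-claim S2; the `p = 15` row)

On a core where every rank-`≤ 5` set has `≤ 8` points and every rank-`≤ 4` set `≤ 7` (the SPREAD case of the nested dichotomy: no set of
nullity `4` on `≤ 9` points, `S2.ncard_le_of_eRk_le_of_not_nullity`), the kit's rank-`≤ 5` tail runs with `f = 8`, `f′ = 7` in the quart
counts (`S2.ncard_eRk_eq_ncard_le_le_sets_quart` at levels `4` and `5`): the weights are `σ_m = σ_g = 1 + 2/5 + 1/15 = 22/15` at both levels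
and the giant terms vanish —
  `#{X ⊆ E : ρ(X) ≤ 5} ≤ C(n, 4) + (22/15)·(s₃·C(n − 3, 2) + s₄·(n − 4) + s₅) + (8·C(n, 3) + 2·C(n, 2) + n + 1)
                          + C(n, 5) + (22/15)·(s₃·C(n − 3, 3) + s₄·C(n − 4, 2) + s₅·(n − 5) + C(d + 5, 6))`
(**`ncard_eRk_le_five_le_spread`**). Against the kit's `f = 19`, `f′ = 10` this drops the tail's slack at `(15, 7)` from `101/1024` to
`91/1024`, the margin the spread case of `(15, 7)` needs (S2 v35 §R3⁗(t)(5)). Axioms: standard.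
-/

open scoped Matroid

namespace PercRepro

namespace ThmN

open Set

variable {α : Type}

/-- **The rank-`≤ 5` tail of a spread core** (`f = 8`, `f′ = 7`; the kit's quart counts at levels `4` and `5`, `σ_m = σ_g = 22/15`). -/
theorem ncard_eRk_le_five_le_spread (M : Matroid α) [M.Finite] (p d : ℕ) (hd6 : 6 ≤ d)
    (hR : M.eRank = (p : ℕ∞)) (hn : M.E.ncard = p + d)
    (hfree : ∀ e ∈ M.E, ∃ A ⊆ M.E \ {e}, e ∉ M.closure A ∧ e ∉ M.closure ((M.E \ {e}) \ A))
    (hflat8 : ∀ X ⊆ M.E, M.eRk X ≤ 5 → X.ncard ≤ 8)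
    (hflat7 : ∀ X ⊆ M.E, M.eRk X ≤ 4 → X.ncard ≤ 7)
    (s3b s4b s5b : ℕ) (hs3 : {C : Set α | M.IsCircuit C ∧ C.ncard = 3}.ncard ≤ s3b)
    (hs4 : {C : Set α | M.IsCircuit C ∧ C.ncard = 4}.ncard ≤ s4b)
    (hs5 : {C : Set α | M.IsCircuit C ∧ C.ncard = 5}.ncard ≤ s5b) :
    ({X : Set α | X ⊆ M.E ∧ M.eRk X ≤ 5}.ncard : ℚ) ≤
      ((p + d).choose 4 : ℚ) + (22 / 15 : ℚ) * ((s3b * (p + d - 3).choose 2 + s4b * (p + d - 4) + s5b : ℕ) : ℚ) +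
      (((p + d).choose 3 * 2 ^ 3 + (p + d).choose 2 * 2 + (p + d) + 1 : ℕ) : ℚ) +
      (((p + d).choose 5 : ℚ) + (22 / 15 : ℚ) *
        ((s3b * (p + d - 3).choose 3 + s4b * (p + d - 4).choose 2 + s5b * (p + d - 5) + (d + 5).choose 6 : ℕ) : ℚ)) := by
  classical
  -- the core is simple: every circuit has `≥ 3` elements
  have hL0 : ∀ e ∈ M.E, ¬ M.IsLoop e := not_isLoop_of_free M hfree
  have hs : ∀ e ∈ M.E, ∀ f ∈ M.E, e ≠ f → M.eRk {e, f} = 2 := by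
    intro e he f hf hef
    have h2 : (2 : ℕ∞) ≤ M.eRk {e, f} :=
      two_le_eRk_of_two_le_ncard_of_free M hfree (pair_subset he hf) (by rw [ncard_pair hef])
    have h3 : M.eRk {e, f} ≤ 2 := by
      have := M.eRk_le_encard {e, f}
      rwa [encard_pair hef] at this
    exact le_antisymm h3 h2
  have hcirc : ∀ C, M.IsCircuit C → 3 ≤ C.encard := three_le_encard_of_circuit M hL0 hs
  have hd : M.E.encard = M.eRank + d := by
    rw [hR, ← M.ground_finite.cast_ncard_eq, hn]
    push_cast
    ring
  have hC1 : ∀ L ⊆ M.E, M.eRk L = 2 → L.ncard ≤ 3 :=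
    fun L hL hr => ncard_le_three_of_eRk_two M hs hfree hL hr
  have hC2 : ∀ P ⊆ M.E, M.eRk P ≤ 3 → P.ncard ≤ 6 :=
    fun P hP hr => ncard_le_six_of_eRk_le_three_of_free M hfree hP hr
  have hs6 : {C | M.IsCircuit C ∧ C.ncard = 6}.ncard ≤ (d + 5).choose 6 :=
    Matroid.ncard_circuits_le_choose_of_encard M hd 5
  have hsum5 := S2.ncard_eRk_le_le_sum M 5
  simp only [Finset.sum_range_succ, Finset.sum_range_zero, zero_add] at hsum5
  -- the rank-`4` sets: `≤ 7` points each, the quart count at level `4` with `f = 7`, `f′ = 6`, `D = 7`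
  have h4 : {X : Set α | X ⊆ M.E ∧ M.eRk X = 4}.ncard ≤
      {B : Set α | B ⊆ M.E ∧ M.eRk B = 4 ∧ B.ncard ≤ 7}.ncard := by
    apply Set.ncard_le_ncard
    · intro X hX
      exact ⟨hX.1, hX.2, hflat7 X hX.1 (by rw [hX.2])⟩
    · exact M.ground_finite.finite_subsets.subset (fun B hB => hB.1)
  have hinter4 : ∀ X ⊆ M.E, M.eRk X ≤ ((4 - 1 : ℕ) : ℕ∞) → (X.ncard : ℕ∞) ≤ M.eRk X + (3 : ℕ) := by
    intro X hX hr
    obtain ⟨k, hk⟩ := Matroid.exists_eRk_eq_nat (M := M) hX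
    rw [hk] at hr ⊢
    have hk3 : k ≤ 3 := by exact_mod_cast hr
    have hcard : X.ncard ≤ k + 3 := by
      rcases Nat.lt_or_ge k 3 with h | h
      · have := ncard_add_one_le_two_pow_of_eRk_le M hL0 hfree k X hX (le_of_eq hk)
        interval_cases k <;> omega
      · have hk' : k = 3 := by omega
        subst hk'
        have := hC2 X hX (le_of_eq hk)
        omega
    exact_mod_cast hcard
  set ν₄ : ℕ := (d + 3) / 2 + 1 with hν₄
  have hflat4' : ∀ X ⊆ M.E, M.eRk X ≤ ((4 - 1 : ℕ) : ℕ∞) → X.ncard ≤ 6 := fun X hX hr =>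
    hC2 X hX (by simpa using hr)
  have hD4 := S2.ncard_eRk_eq_ncard_le_le_sets_quart M 4 7 6 ν₄ 3 7 (by norm_num)
    hcirc hC1 hC2 hflat7 hflat4' hinter4 hd (by omega) (by omega) (by omega)
  have hm41 : min (7 - (4 + 1)) (ν₄ - 2) = 2 := by omega
  have hm43 : min 7 (4 + d) = 7 := by omega
  rw [hn, sum_Icc_three_five_q, hm41, hm43] at hD4
  simp only [show (4 : ℕ) + 1 = 5 from rfl, show (5 : ℕ) - 3 = 2 from rfl, show (5 : ℕ) - 4 = 1 from rfl,
    show (5 : ℕ) - 5 = 0 from rfl, Nat.choose_one_right, Nat.choose_zero_right] at hD4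
  norm_num [Finset.sum_range_succ, Nat.choose] at hD4
  have hsm4 : {C | M.IsCircuit C ∧ C.ncard = 3}.ncard * (p + d - 3).choose 2 +
      {C | M.IsCircuit C ∧ C.ncard = 4}.ncard * (p + d - 4) +
      {C | M.IsCircuit C ∧ C.ncard = 5}.ncard ≤
      s3b * (p + d - 3).choose 2 + s4b * (p + d - 4) + s5b := by
    gcongr
  have hsm4q : (({C | M.IsCircuit C ∧ C.ncard = 3}.ncard : ℚ) * ((p + d - 3).choose 2 : ℚ) +
      ({C | M.IsCircuit C ∧ C.ncard = 4}.ncard : ℚ) * ((p + d - 4 : ℕ) : ℚ) +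
      ({C | M.IsCircuit C ∧ C.ncard = 5}.ncard : ℚ)) ≤
      ((s3b * (p + d - 3).choose 2 + s4b * (p + d - 4) + s5b : ℕ) : ℚ) := by exact_mod_cast hsm4
  have hD4q : ({B : Set α | B ⊆ M.E ∧ M.eRk B = 4 ∧ B.ncard ≤ 7}.ncard : ℚ) ≤ ((p + d).choose 4 : ℚ) +
      (22 / 15 : ℚ) * ((s3b * (p + d - 3).choose 2 + s4b * (p + d - 4) + s5b : ℕ) : ℚ) := by
    refine hD4.trans ?_
    push_cast at hsm4q ⊢
    linarith
  -- the rank-`≤ 3` sets through their closures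
  have h3 : {X : Set α | X ⊆ M.E ∧ M.eRk X = (3 : ℕ)}.ncard ≤ M.E.ncard.choose 3 * 2 ^ (6 - 3) :=
    S2.ncard_eRk_eq_le_choose_mul_two_pow M 3 6
      (fun X hX hr => ncard_le_six_of_eRk_le_three_of_free M hfree hX (by exact_mod_cast hr))
  have h2 : {X : Set α | X ⊆ M.E ∧ M.eRk X = (2 : ℕ)}.ncard ≤ M.E.ncard.choose 2 * 2 ^ (3 - 2) :=
    S2.ncard_eRk_eq_le_choose_mul_two_pow M 2 3
      (fun X hX hr => by
        have := ncard_add_one_le_two_pow_of_eRk_le M hL0 hfree 2 X hX hr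
        omega)
  have h1 : {X : Set α | X ⊆ M.E ∧ M.eRk X = (1 : ℕ)}.ncard ≤ M.E.ncard.choose 1 * 2 ^ (1 - 1) :=
    S2.ncard_eRk_eq_le_choose_mul_two_pow M 1 1
      (fun X hX hr => by
        have := ncard_add_one_le_two_pow_of_eRk_le M hL0 hfree 1 X hX hr
        omega)
  have h0 : {X : Set α | X ⊆ M.E ∧ M.eRk X = (0 : ℕ)}.ncard ≤ M.E.ncard.choose 0 * 2 ^ (0 - 0) :=
    S2.ncard_eRk_eq_le_choose_mul_two_pow M 0 0
      (fun X hX hr => by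
        have := ncard_add_one_le_two_pow_of_eRk_le M hL0 hfree 0 X hX hr
        omega)
  -- the rank-`5` sets: `≤ 8` points each, the quart count at level `5` with `f = 8`, `f′ = 7`, `D = 8`
  have h5 : {X : Set α | X ⊆ M.E ∧ M.eRk X = 5}.ncard ≤
      {B : Set α | B ⊆ M.E ∧ M.eRk B = 5 ∧ B.ncard ≤ 8}.ncard := by
    apply Set.ncard_le_ncard
    · intro X hX
      exact ⟨hX.1, hX.2, hflat8 X hX.1 (le_of_eq hX.2)⟩
    · exact M.ground_finite.finite_subsets.subset (fun B hB => hB.1)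
  set ν₁ : ℕ := (d + 6) / 2 + 1 with hν₁
  have hflat7' : ∀ X ⊆ M.E, M.eRk X ≤ ((5 - 1 : ℕ) : ℕ∞) → X.ncard ≤ 7 := fun X hX hr =>
    hflat7 X hX (by simpa using hr)
  have hD0 := S2.ncard_eRk_eq_ncard_le_le_sets_quart M 5 8 7 ν₁ 6 8 (by norm_num)
    hcirc hC1 hC2 hflat8 hflat7' (hinter_five M hfree) hd (by omega) (by omega) (by omega)
  have hm1 : min (8 - (5 + 1)) (ν₁ - 2) = 2 := by omega
  have hm3 : min 8 (5 + d) = 8 := by omega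
  rw [hn, sum_Icc_three_six_q, hm1, hm3] at hD0
  simp only [show (5 : ℕ) + 1 = 6 from rfl, show (6 : ℕ) - 3 = 3 from rfl, show (6 : ℕ) - 4 = 2 from rfl,
    show (6 : ℕ) - 5 = 1 from rfl, show (6 : ℕ) - 6 = 0 from rfl, Nat.choose_one_right,
    Nat.choose_zero_right] at hD0
  norm_num [Finset.sum_range_succ, Nat.choose] at hD0
  have hsm : {C | M.IsCircuit C ∧ C.ncard = 3}.ncard * (p + d - 3).choose 3 +
      {C | M.IsCircuit C ∧ C.ncard = 4}.ncard * (p + d - 4).choose 2 +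
      {C | M.IsCircuit C ∧ C.ncard = 5}.ncard * (p + d - 5) + {C | M.IsCircuit C ∧ C.ncard = 6}.ncard ≤
      s3b * (p + d - 3).choose 3 + s4b * (p + d - 4).choose 2 + s5b * (p + d - 5) + (d + 5).choose 6 := by
    gcongr
  have hsmq : (({C | M.IsCircuit C ∧ C.ncard = 3}.ncard : ℚ) * ((p + d - 3).choose 3 : ℚ) +
      ({C | M.IsCircuit C ∧ C.ncard = 4}.ncard : ℚ) * ((p + d - 4).choose 2 : ℚ) +
      ({C | M.IsCircuit C ∧ C.ncard = 5}.ncard : ℚ) * ((p + d - 5 : ℕ) : ℚ) +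
      ({C | M.IsCircuit C ∧ C.ncard = 6}.ncard : ℚ)) ≤
      ((s3b * (p + d - 3).choose 3 + s4b * (p + d - 4).choose 2 + s5b * (p + d - 5) + (d + 5).choose 6 : ℕ) : ℚ) := by
    exact_mod_cast hsm
  have hDq : ({B : Set α | B ⊆ M.E ∧ M.eRk B = 5 ∧ B.ncard ≤ 8}.ncard : ℚ) ≤ ((p + d).choose 5 : ℚ) +
      (22 / 15 : ℚ) * ((s3b * (p + d - 3).choose 3 + s4b * (p + d - 4).choose 2 + s5b * (p + d - 5) + (d + 5).choose 6 : ℕ) : ℚ) := by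
    refine hD0.trans ?_
    push_cast at hsmq ⊢
    linarith
  -- assemble
  norm_num [Nat.choose_one_right] at h3 h2 h1 h0
  rw [hn] at h3 h2 h1
  have hA4 : {X : Set α | X ⊆ M.E ∧ M.eRk X ≤ 5}.ncard ≤
      {B : Set α | B ⊆ M.E ∧ M.eRk B = 4 ∧ B.ncard ≤ 7}.ncard +
      ((p + d).choose 3 * 2 ^ 3 + (p + d).choose 2 * 2 + (p + d) + 1) +
      {B : Set α | B ⊆ M.E ∧ M.eRk B = 5 ∧ B.ncard ≤ 8}.ncard := by
    push_cast at hsum5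
    omega
  have hA4q : ({X : Set α | X ⊆ M.E ∧ M.eRk X ≤ 5}.ncard : ℚ) ≤
      ({B : Set α | B ⊆ M.E ∧ M.eRk B = 4 ∧ B.ncard ≤ 7}.ncard : ℚ) +
      (((p + d).choose 3 * 2 ^ 3 + (p + d).choose 2 * 2 + (p + d) + 1 : ℕ) : ℚ) +
      ({B : Set α | B ⊆ M.E ∧ M.eRk B = 5 ∧ B.ncard ≤ 8}.ncard : ℚ) := by exact_mod_cast hA4
  exact hA4q.trans (add_le_add (add_le_add hD4q le_rfl) hDq)

end ThmN

end PercRepro
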